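import Mathlib
import Literature.MathematicalPhysics.QuantumFieldTheory.Balaban1983to89.B13Bound143OneShot
import Literature.MathematicalPhysics.QuantumFieldTheory.Balaban1983to89.TreeLengthCubeSystem
import Literature.MathematicalPhysics.QuantumFieldTheory.Balaban1983to89.B12Ext436Lattice
import Literature.MathematicalPhysics.QuantumFieldTheory.Balaban1983to89.B6KernelComposition
import Literature.MathematicalPhysics.QuantumFieldTheory.Balaban1983to89.B13PerturbativeStep

/-!
# `Balaban1983to89.B13Resum220` — (2.19) ⇒ (2.20) of B13 p. 16: the resummation of the quadratic forms (2.19) over the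
# localization domains Y ∈ 𝐃 through the cube of a bond, the Schur step, and the V″ sum, with BOTH printed "O(1)"
# EXPLICIT (lattice-animal count in the number of cubes; unit-lattice row sums; (1.26) for the tree length); d = 4:
# numerical thresholds and an M-uniform constant

CITATION HEADER (lean-in-tree rule 2026-08-18). T. Bałaban, *Renormalization group approach to lattice gauge field
theories. II. Cluster expansions*, Commun. Math. Phys. **116**, 1–22 (1988), doi:10.1007/bf01239022
[Balaban1988RG2Cluster] (cell paper B13; held `paper:balaban1988-cmp116-rg-ii-cluster`, journal page = PDF page), pp.
8, 9, 16; for the notion of a localization domain T. Bałaban, *Renormalization group approach to lattice gauge field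
theories. I. …*, Commun. Math. Phys. **109**, 249–301 (1987) [Balaban1987RG1] (cell paper B12), p. 257. The displays
(1.26), (1.28), (2.19), (2.20) and the sentences around them quoted below were compared with the renders
`b2b-balaban-ref1/pages/1988-cmp116-rg-II-cluster/1988-cmp116-rg-II-cluster-p008-x2.png` and `…-p016-x2.png` READ AS
IMAGES (2026-08-19), not from the OCR layer. The paper is UNDER ADJUDICATION by the audit cell `pub-balaban`; nothing
of it is asserted here. What is proved below is ELEMENTARY REAL-VARIABLE AND LATTICE COMBINATORICS (finite sums,
`Real.exp`, the sup metric of `Fin d → ℤ`), proved by the kernel from Mathlib and from the following tree theorems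
USED BY NAME (nothing of them is modified or restated): the lattice-animal geometric series
`Literature.Probability.LatticeModels.sum_pow_card_le_of_connected` (`…PolymerGasGeometric`), the constants `a₀`,
`kappa₀`, `K₀` with `smallness_a₀`, `exp_neg_a₀` of `…B12TreeDecay` (unit pv03), the ℤ^d index model `Pt`, `Adj`,
`FaceConnected`, `Linked`, `StepIn` of `…B13ScaleTransfer` (unit pv11), the tree length `treeLen` of
`…TreeLength` and the threshold `kappa₀_four` of `…TreeLengthCubeSystem` (unit pv22), the cube model of ℤ^d `nbrZ`,
`mem_nbrZ`, `card_nbrZ_le`, `isRConnected_of_faceConnected` and (1.26)-for-the-tree-length on ℤ^d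
`B12Ext436Lattice.sum_exp_treeLen_le` of `…B12Ext436Lattice` (unit b03), the window-uniform lattice sum
`B6KernelComposition.latticeConst` / `sum_exp_dist_le` (unit b06-g3), the (2.21) Schur ∕ AM–GM lemma
`B13PerturbativeStep.norm_bilinForm_le` (this lineage, gen 5), and `B13Bound143.invTau` ((2.18)), `B13Bound143.elem219` (the
matrix element of (2.19)), `B13Bound143.invTau_pos` of `…B13Bound143OneShot` (this lineage, gen 23) over the records
`B13.Consts`, `B13.StepData`, `B13.Bound136` of `…B13` (unit r2/b13). This module is a NEW LEAF: it imports
`B13Bound143OneShot`, `TreeLengthCubeSystem`, `B12Ext436Lattice`, `B6KernelComposition`, `B13PerturbativeStep` and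
modifies nothing. Unit
`b2b-balaban-b13-g26` (paper sub-cell B13, gen 26); cell records GAPS C-B13-58 (this leaf), C-B13-35 UPDATE-8 (census
CENSUS-B13-v2 v2.8: §2 row (2.19)–(2.20), class K∣P → K for the combinatorial passage; the analytic inputs stay as
recorded in their own rows), DIVERGENCE D-b13.35 (the modelling conventions and the reading note on "(1.28)" stated
below).

WHAT IS PRINTED (verbatim).
* [Balaban1988RG2Cluster] p. 16, after (2.18) *"1/|τ(Y)| = E₀ε₁C₁α₄⁻¹M^q exp C₂κ₁ exp(−(1 − 3δ)κd_k(Y))"* and (2.19)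
  *"½ Σ_{b,b′⊂Y} α₄M⁻⁴exp(−¼(κ₁ − 1)M⁻⁴|Y| − (1/16)(κ₁ − 1)M⁻¹|b₋ − b′₋|)|B(b)||B(b′)|"*: *"The sum of these quadratic
  forms over Y∈𝐃 is bounded by a quadratic form with the above matrix elements resummed over all Y∈𝐃_k containing, for
  example, the point b₋. We use the first exponential factor in (2.19) to bound the sum, and this yields a constant
  O(1). In fact the constant is small for κ₁ large, hence we can bound it by 1. Using (1.28) we obtain
  Σ_{Y∈𝐃}|τ(Y)||V_k(Y,B)| ≦ ½Σ_{b,b′⊂Y₀}α₄M⁻⁴exp(−(1/16)(κ₁ − 1)M⁻¹|b₋ − b′₋|)|B(b)||B(b′)| + Σ_{Y∈𝐃}α₄exp(−δκd_k(Y))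
  ≦ ½O(1)α₄Σ_{b⊂Y₀}|B(b)|² + O(1)α₄M⁻⁴|Y₀|. (2.20)"* Here 𝐃 is the subfamily of DISTINCT localization domains of the
  Mayer term (p. 12, (2.1)) and Y₀ = ⋃_{Y∈𝐃} Y (p. 12); V_k(Y, B) = the quadratic form of (1.42) + V″_k(Y, B), the
  latter bounded by (1.36) p. 9: *"E₀ε₁C₁M^q exp C₂κ₁ exp(−(1 − 2δ)κd_k(Y))"* on the space (1.34).
* [Balaban1988RG2Cluster] p. 8: *"Σ_{X∈𝐃_j, X⊃□′} exp(−κd_j(X)) ≦ O(1), (1.26) for κ sufficiently large. The number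
  O(1) is in fact small, because we sum over X with d_j(X) ≠ 0, as it follows from our inductive construction. This
  inequality was used many times in convergence proofs for cluster expansions, for example see [48, 50, 40, 26, 3]."*
  and *"M⁻⁴|Y| ≦ 3·2³d_k(Y) ≦ exp(1/16)(κ₁ − 2)d_k(Y). (1.28)"*.
* [Balaban1987RG1] p. 257 (the domains): cubes of side M, rescaled to unit cubes; a localization domain is a connected
  family of cubes, *"two consecutive cubes have a common wall"* (typed by pv11 as `B13ScaleTransfer.FaceConnected` on
  cube indices x ∈ ℤ^d with `Adj` = y = x ± e_i); d_k(Y) = the length of a shortest tree through the cubes, in the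
  rescaled metric (typed by pv22 as `TreeLength.treeLen`). The norm |·| on points is named neither in [I] nor in [II]
  (cell DIVERGENCE D-T2). No argument beyond the quoted sentences is printed for (2.20).

WHAT THIS FILE CERTIFIES (zero `sorry`; d arbitrary unless stated).
* §1 THE RESUMMATION (the sentence after (2.19)). `sum_exp_card_le`: for cells `V` with a symmetric adjacency `R` of
  degree ≤ Δ and `a ≥ a₀(Δ) = log 2(Δ+1)²`, every finite family 𝒴 of `R`-connected cell sets through a cell q has
  **Σ_{Y∈𝒴} e^{−a·#Y} ≤ (Δ+1)^{−2}** (the tree's animal series at λ = e^{−a₀}, (Δ+1)²λ = ½) — "a constant O(1) … small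
  for κ₁ large, hence we can bound it by 1", CERTIFIED with a = ¼(κ₁ − 1), #Y = M⁻⁴|Y|; `wt`, `wt_nonneg`,
  `sum_wt_le`; and `resum_quadForm`: for a finite family D of `R`-connected sets, bond sets `sY Y ⊆ s` whose cubes lie
  in Y, and F ≥ 0 on s × s, **Σ_{Y∈D} Σ_{b,b′∈sY Y} e^{−a#Y} F(b,b′) ≤ (Δ+1)^{−2} Σ_{b,b′∈s} F(b,b′)** (enlarge each
  form to s with the weight 1_{□(b)∈Y} e^{−a#Y}, exchange the sums, resum over Y ∋ □(b)).
* §2 THE SCHUR STEP. `quadForm_le_of_rowSum`: a non-negative symmetric kernel K on s with row sums ≤ C has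
  **Σ_{b,b′∈s} K(b,b′)θ_bθ_{b′} ≤ C·Σ_{b∈s} θ_b²** — from the tree's (2.21) lemma
  `B13PerturbativeStep.norm_bilinForm_le` at 𝕜 = ℝ, n = ↥s.
* §3 UNIT-LATTICE ROW SUMS. `rowSum_exp_dist_le`: bonds b ∈ s with initial points `site b ∈ ℤ^d`, at most m per point,
  a > 0: **Σ_{b′∈s} e^{−a·|x − site b′|_∞} ≤ m·C(d, a)**, C = `B6KernelComposition.latticeConst` (fibrewise over the
  initial points, then the window-uniform lattice sum of unit b06); `latticeConst_le`: **C(d, a) ≤ (2(1 + d/a))^d** (1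
  + t ≤ e^t); `rowConst_four_le`: for M ≥ 1, κ₁ > 1, **M⁻⁴·C(4, (κ₁−1)/(16M)) ≤ (2 + 128/(κ₁−1))⁴** — in d = 4 the M⁴
  of the row sum at rate (κ₁−1)/(16M) cancels the M⁻⁴ of the matrix element EXACTLY, so the "O(1)" is M-UNIFORM.
* §4 THE TWO MATRIX ELEMENTS OF (2.20) over `B13.Consts`: `ker220 c ρ = α₄M⁻⁴e^{−(1/16)(κ₁−1)M⁻¹ρ}` (first term),
  `vpp220 c d = α₄e^{−δκd}` (second term), `rhs136` (= the right side of (1.36); `bound136_iff_rhs136 : B13.Bound136 S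
  c F ↔ …` by `Iff.rfl`), `O1 c d m = m·M⁻⁴·C(d, (κ₁−1)/(16M))`; `elem219_eq_exp_mul_ker220` (**the matrix element of
  (2.19) FACTORS as e^{−¼(κ₁−1)n} · ker220** — "the first exponential factor in (2.19)"); `ker220_nonneg`,
  `ker220_antitone`, `ker220_eq`; `rowSum_ker220_le` (**Σ_{b′∈s} ker220(ρ(b,b′)) ≤ O1·α₄** for any distance reading ρ
  ≥ the sup distance of the initial points — ℓ¹ and ℓ² are ≥ sup, so all three readings of D-T2 are served);
  `invTau_mul_vpp220` (**(1/|τ|)·α₄ e^{−δκd} = rhs136 EXACTLY**: the rates add, (1 − 3δ) + δ = 1 − 2δ),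
  `invTau_inv_mul_rhs136`, and `vpp_of_bound136`: from the record statement `B13.Bound136 S c F` ((1.36) for F =
  V″_k), **|τ(Y)|·‖F Y φ‖ ≤ α₄e^{−δκd_k(Y)}** on the space (1.34) of every domain Y of the abstract step data (E₀, ε₁,
  C₁, α₄, M > 0).
* §5 (2.20) OVER ABSTRACT DATA. `sum_le_sum_biUnion` (union bound over the cubes of Y₀ = ⋃ D: Σ_{Y∈D} f(Y) ≤ Σ_{□∈Y₀}
  Σ_{Y∈D, Y∋□} f(Y) for f ≥ 0, non-empty members); `ineq220_middle` = **the FIRST inequality of (2.20)**: given per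
  (Y, b, b′) the bound q(Y,b,b′) ≤ elem219(#Y, ρ(b,b′)) (the shape delivered by `B13Bound143.tau_mul_le_elem219` ∕
  `B13DiameterG6.tau_mul_le_elem219_sup/_l1/_l2` for q = |τ(Y)|·|matrix element of (1.42)|), per Y the bound v(Y) ≤
  vpp220(d_k(Y)) (the shape of `vpp_of_bound136` for v = |τ(Y)||V″_k(Y,B)|), θ = |B(·)| ≥ 0 and ¼(κ₁−1) ≥ a₀(Δ):
  Σ_{Y∈D}(½Σ_{b,b′⊂Y} qθθ + v(Y)) ≤ ½Σ_{b,b′⊂Y₀} ker220(ρ)θθ + Σ_{Y∈D} α₄e^{−δκd_k(Y)}; `ineq220` = **BOTH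
  inequalities**, the two O(1)'s as hypotheses on the model: row sums of ker220 ≤ C on the bonds of Y₀ and Σ_{Y∈D,
  Y∋□} e^{−δκd_k(Y)} ≤ K for every cube □ of Y₀ give **… ≤ ½·C·Σ_{b⊂Y₀}θ_b² + K·α₄·#Y₀** (#Y₀ = the number of cubes of
  Y₀ = M⁻⁴|Y₀|).
* §6 THE LATTICE INSTANCE (cube model and (1.26) of unit b03's `B12Ext436Lattice`). `ineq220_lattice`: V = ℤ^d cube
  indices, R = common-wall adjacency (≤ 2d neighbours), D a finite
  family of distinct localization domains (non-empty, face-connected), initial points on the unit lattice ℤ^d with ≤ m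
  bonds per point, ρ symmetric ≥ sup distance, d_k := `treeLen`; under ¼(κ₁−1) ≥ a₀(2d), κ₁ > 1, M > 0, α₄ ≥ 0, δκ ≥
  κ₀(4·2^d, 2d): **Σ_{Y∈D}(½Σ qθθ + v(Y)) ≤ ½(O1·α₄)Σ_{b⊂Y₀}θ_b² + K₀(4·2^d, 2d)·α₄·#Y₀** — the second O(1) is b03's
  theorem `B12Ext436Lattice.sum_exp_treeLen_le` ((1.26) for the tree length on ℤ^d, constant K₀ of pv03/pv22) applied
  to the members of D through each cube of Y₀; `ineq220_four` (d = 4):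
  under **κ₁ ≥ 1 + 4 log 162** (≈ 21.35), **δκ ≥ 64 log 162** (≈ 325.6 = κ₀(64, 8), `kappa₀_four`), M ≥ 1, α₄ ≥ 0: **…
  ≤ ½·(m(2 + 128/(κ₁−1))⁴·α₄)·Σ_{b⊂Y₀}θ_b² + K₀(64, 8)·α₄·#Y₀** — both "O(1)" of (2.20) are absolute numbers.

WHAT IS *NOT* REPRODUCED OR ASSERTED (HONEST SCOPE). (i) Every ANALYTIC input is a hypothesis in the shape the tree's
earlier leaves deliver it: (2.19) per (Y, b, b′) (`hq`), (1.36) for V″_k (`hv` ∕ `vpp_of_bound136`); nothing is said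
about (1.42), (1.43), (1.36) themselves, about τ, V_k, the fields B, or the series (2.13). (ii) The DICTIONARY is the
joiner's, not made here: V_k(Y,B) = quadratic form + V″_k ((1.42)) ↦ the pair (q, v); "b ⊂ Y" ↦ `b ∈ sY Y` with `cube
b ∈ Y`; b₋ ↦ `site b ∈ ℤ^d` (the unit lattice of the k-th step; at most m bonds per initial point, m = d for
positively oriented bonds); |b₋ − b′₋| ↦ any symmetric `ρ ≥ dist (site b) (site b′)` (sup metric; D-T2); M⁻⁴|Y| ↦
`#Y`; d_k ↦ `treeLen` (pv22) in §6 and the abstract `S.Dk.dj` in `vpp_of_bound136` — their identification is NOT made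
here; the torus T of [II] versus the window ℤ^d (distances and cubes are taken in ℤ^d). (iii) "resummed over all Y ∈
𝐃_k containing … b₋": the kernel statement resums over the members of the given finite family through the cube of b
and bounds that by the animal series over ALL face-connected finite families through it — the print's 𝐃_k-sum
restricted to any finite window is such a family; no statement about 𝐃_k itself (an object of the inductive
construction) is made. (iv) READING NOTE on *"Using (1.28) we obtain"* (DIVERGENCE D-b13.35): on the route certified
here (1.28) is not needed — the Y-resummation is controlled by the animal count in the NUMBER OF CUBES with the volume
weight e^{−¼(κ₁−1)M⁻⁴|Y|} itself, and the V″ sum by the union bound over the cubes of Y₀ with (1.26) for the tree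
length — and we do not determine which use of (1.28) the author intends (the cell transcript's CHECK of p. 16 reaches
the same two O(1)'s through the upper half of (2.30) and (1.26)); the printed thresholds "κ₁ large", "κ sufficiently
large" are replaced by the explicit ones above, which are this file's, not the paper's. (v) The second "O(1)" is
the tree's K₀(4·2^d, 2d) (pv03/pv22/b03) for ITS formalised tree length and ITS (1.26); the constant of the paper's (1.26) (refs. [48, 50,
40, 26, 3] of [II]) is not discussed. Value = the combinatorial passage (2.19) ⇒ (2.20) of census §2 turned from
"checked on paper ∕ by reference" into a kernel fact with explicit constants — located-gap bookkeeping, NOT summit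
progress.
-/

namespace Literature.MathematicalPhysics.QuantumFieldTheory.Balaban1983to89.B13Resum220

noncomputable section

open Finset
open Literature.Probability.LatticeModels (IsRConnected sum_pow_card_le_of_connected)
open Literature.MathematicalPhysics.QuantumFieldTheory.Balaban1983to89.B12TreeDecay (a₀ kappa₀ K₀ smallness_a₀
  exp_neg_a₀)
open Literature.MathematicalPhysics.QuantumFieldTheory.Balaban1983to89.B13ScaleTransfer (Pt Adj FaceConnected)
open Literature.MathematicalPhysics.QuantumFieldTheory.Balaban1983to89.TreeLength (treeLen)
open Literature.MathematicalPhysics.QuantumFieldTheory.Balaban1983to89.B12Ext436Lattice (nbrZ mem_nbrZ card_nbrZ_le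
  isRConnected_of_faceConnected sum_exp_treeLen_le)
open Literature.MathematicalPhysics.QuantumFieldTheory.Balaban1983to89.B6KernelComposition (latticeConst
  sum_exp_dist_le)
open Literature.MathematicalPhysics.QuantumFieldTheory.Balaban1983to89.B13Bound143 (invTau elem219 invTau_pos)

/-! ## §1 The resummation over the localization domains containing a given cube (a lattice-animal geometric series) -/

section Resum

variable {V : Type*} [DecidableEq V] {R : V → V → Prop} {nbr : V → Finset V} {Δ : ℕ}

/-- The animal sum with VOLUME decay through a cell, for a plain finite family of `R`-connected sets: if every cell
has at most `Δ` `R`-neighbours and `a ≥ a₀(Δ) = log 2(Δ+1)²`, then `Σ_{Y ∈ 𝒴} e^{−a·#Y} ≤ (Δ+1)^{−2}` for every finite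
family `𝒴` of `R`-connected sets through the cell `q` (the tree's `sum_pow_card_le_of_connected` at `λ = e^{−a₀}`,
`(Δ+1)²λ = ½`, and monotonicity in `a`; cf. `B12TreeDecay.sum_exp_vol_le` for `CubeSystem`s). [folklore] -/
theorem sum_exp_card_le (hR : ∀ x y, R x y → R y x) (hΔ : ∀ x, (nbr x).card ≤ Δ)
    (hnbr : ∀ x y, R x y → y ∈ nbr x) {a : ℝ} (ha : a₀ Δ ≤ a) (q : V) (𝒴 : Finset (Finset V))
    (h𝒴 : ∀ Y ∈ 𝒴, q ∈ Y ∧ IsRConnected R Y) :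
    ∑ Y ∈ 𝒴, Real.exp (-(a * Y.card)) ≤ 1 / ((Δ : ℝ) + 1) ^ 2 := by
  have hmono : ∀ Y ∈ 𝒴, Real.exp (-(a * Y.card)) ≤ Real.exp (-a₀ Δ) ^ Y.card := by
    intro Y _
    rw [← Real.exp_nat_mul]
    apply Real.exp_le_exp.2
    have h0 : (0 : ℝ) ≤ Y.card := Nat.cast_nonneg _
    nlinarith
  refine (sum_le_sum hmono).trans ?_
  have h := sum_pow_card_le_of_connected hR hΔ hnbr (Real.exp_nonneg _) (smallness_a₀ Δ) q 𝒴 h𝒴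
  refine h.trans (le_of_eq ?_)
  rw [exp_neg_a₀]
  have hpos : (0 : ℝ) < ((Δ : ℝ) + 1) ^ 2 := by positivity
  field_simp

variable {β : Type*}

/-- The resummation weight of a bond `b` in a domain `Y`: `e^{−a·#Y}` if the cube of `b` is one of the cubes of `Y`,
else `0`. [folklore] -/
def wt (cube : β → V) (a : ℝ) (Y : Finset V) (b : β) : ℝ :=
  if cube b ∈ Y then Real.exp (-(a * Y.card)) else 0

omit [DecidableEq V] in
/-- The weight is non-negative. [folklore] -/
theorem wt_nonneg [DecidableEq V] (cube : β → V) (a : ℝ) (Y : Finset V) (b : β) : 0 ≤ wt cube a Y b := by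
  unfold wt
  split_ifs
  · exact Real.exp_nonneg _
  · exact le_rfl

/-- **Resummed weight through the cube of a bond**: `Σ_{Y ∈ D} wt(Y, b) = Σ_{Y ∈ D, Y ∋ □(b)} e^{−a#Y} ≤ (Δ+1)^{−2}` for a
family `D` of `R`-connected sets and `a ≥ a₀(Δ)`. [folklore] -/
theorem sum_wt_le (hR : ∀ x y, R x y → R y x) (hΔ : ∀ x, (nbr x).card ≤ Δ)
    (hnbr : ∀ x y, R x y → y ∈ nbr x) {a : ℝ} (ha : a₀ Δ ≤ a) (D : Finset (Finset V))
    (hD : ∀ Y ∈ D, IsRConnected R Y) (cube : β → V) (b : β) :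
    ∑ Y ∈ D, wt cube a Y b ≤ 1 / ((Δ : ℝ) + 1) ^ 2 := by
  unfold wt
  rw [← sum_filter]
  exact sum_exp_card_le hR hΔ hnbr ha (cube b) (D.filter fun Y => cube b ∈ Y) fun Y hY => by
    rw [mem_filter] at hY
    exact ⟨hY.2, hD Y hY.1⟩

/-- **THE RESUMMATION OF A FAMILY OF QUADRATIC FORMS** ([Balaban1988RG2Cluster] p. 16, the sentence after (2.19):
*"The sum of these quadratic forms over Y∈D is bounded by a quadratic form with the above matrix elements resummed
over all Y ∈ 𝐃_k containing, for example, the point b₋. We use the first exponential factor in (2.19) to bound the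
sum, and this yields a constant O(1). In fact the constant is small for κ₁ large, hence we can bound it by 1."*),
kernel form over abstract data: cells `V` with a symmetric adjacency `R` of degree `≤ Δ`; a finite family `D` of
`R`-connected cell sets; the bonds of `Y` are `sY Y ⊆ s` (`s` = the bonds of Y₀) and the cube `cube b` of a bond of
`Y` lies in `Y`; `F ≥ 0` on `s × s`.  Then for `a ≥ a₀(Δ) = log 2(Δ+1)²`:
`Σ_{Y∈D} Σ_{b,b′ ⊂ Y} e^{−a#Y} F(b,b′) ≤ (Δ+1)^{−2} Σ_{b,b′ ⊂ Y₀} F(b,b′)` — the "constant O(1)" is `(Δ+1)^{−2} ≤ 1`.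
[cite: Balaban1988RG2Cluster, p.16 (between (2.19) and (2.20))] -/
theorem resum_quadForm (hR : ∀ x y, R x y → R y x) (hΔ : ∀ x, (nbr x).card ≤ Δ)
    (hnbr : ∀ x y, R x y → y ∈ nbr x) {a : ℝ} (ha : a₀ Δ ≤ a) (D : Finset (Finset V))
    (hD : ∀ Y ∈ D, IsRConnected R Y) (s : Finset β) (sY : Finset V → Finset β)
    (hsY : ∀ Y ∈ D, sY Y ⊆ s) (cube : β → V) (hcube : ∀ Y ∈ D, ∀ b ∈ sY Y, cube b ∈ Y)
    (F : β → β → ℝ) (hF : ∀ b ∈ s, ∀ b' ∈ s, 0 ≤ F b b') :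
    ∑ Y ∈ D, ∑ b ∈ sY Y, ∑ b' ∈ sY Y, Real.exp (-(a * Y.card)) * F b b'
      ≤ 1 / ((Δ : ℝ) + 1) ^ 2 * ∑ b ∈ s, ∑ b' ∈ s, F b b' := by
  -- Step 1: enlarge each quadratic form to the full bond set `s`, with the weight `wt`
  have h1 : ∀ Y ∈ D, ∑ b ∈ sY Y, ∑ b' ∈ sY Y, Real.exp (-(a * Y.card)) * F b b'
      ≤ ∑ b ∈ s, ∑ b' ∈ s, wt cube a Y b * F b b' := by
    intro Y hY
    calc ∑ b ∈ sY Y, ∑ b' ∈ sY Y, Real.exp (-(a * Y.card)) * F b b'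
        = ∑ b ∈ sY Y, ∑ b' ∈ sY Y, wt cube a Y b * F b b' := by
          refine sum_congr rfl fun b hb => sum_congr rfl fun b' _ => ?_
          rw [wt, if_pos (hcube Y hY b hb)]
      _ ≤ ∑ b ∈ sY Y, ∑ b' ∈ s, wt cube a Y b * F b b' := by
          refine sum_le_sum fun b hb => sum_le_sum_of_subset_of_nonneg (hsY Y hY) fun b' hb' _ => ?_
          exact mul_nonneg (wt_nonneg cube a Y b) (hF b (hsY Y hY hb) b' hb')
      _ ≤ ∑ b ∈ s, ∑ b' ∈ s, wt cube a Y b * F b b' := by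
          refine sum_le_sum_of_subset_of_nonneg (hsY Y hY) fun b hb _ => ?_
          exact sum_nonneg fun b' hb' => mul_nonneg (wt_nonneg cube a Y b) (hF b hb b' hb')
  -- Step 2: exchange the sums and resum the weight over `Y ∋ □(b)`
  calc ∑ Y ∈ D, ∑ b ∈ sY Y, ∑ b' ∈ sY Y, Real.exp (-(a * Y.card)) * F b b'
      ≤ ∑ Y ∈ D, ∑ b ∈ s, ∑ b' ∈ s, wt cube a Y b * F b b' := sum_le_sum h1
    _ = ∑ b ∈ s, ∑ b' ∈ s, (∑ Y ∈ D, wt cube a Y b) * F b b' := by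
        rw [sum_comm]
        refine sum_congr rfl fun b _ => ?_
        rw [sum_comm]
        refine sum_congr rfl fun b' _ => ?_
        rw [sum_mul]
    _ ≤ ∑ b ∈ s, ∑ b' ∈ s, 1 / ((Δ : ℝ) + 1) ^ 2 * F b b' := by
        refine sum_le_sum fun b hb => sum_le_sum fun b' hb' => ?_
        exact mul_le_mul_of_nonneg_right (sum_wt_le hR hΔ hnbr ha D hD cube b) (hF b hb b' hb')
    _ = 1 / ((Δ : ℝ) + 1) ^ 2 * ∑ b ∈ s, ∑ b' ∈ s, F b b' := by
        rw [mul_sum]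
        refine sum_congr rfl fun b _ => ?_
        rw [mul_sum]

end Resum

/-! ## §2 The quadratic-form step: the Schur / AM–GM bound of (2.21), from row sums -/

section Schur

variable {β : Type*}

/-- **A quadratic form with a non-negative symmetric kernel is bounded by (max row sum) × Σ θ²**:
`Σ_{b,b′ ∈ s} K(b,b′) θ_b θ_{b′} ≤ C Σ_{b ∈ s} θ_b²` when every row of `K` on `s` sums to at most `C` — the bound
*"½Σ_{b,b′⊂Y₀} … |B(b)||B(b′)| ≤ ½O(1)α₄Σ_{b⊂Y₀}|B(b)|²"* of (2.20), obtained here from the tree's kernel-checked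
(2.21) Schur / AM–GM lemma `B13PerturbativeStep.norm_bilinForm_le` (rows = columns by symmetry).
[cite: Balaban1988RG2Cluster, (2.20) p.16 (second inequality, first term)] -/
theorem quadForm_le_of_rowSum (s : Finset β) (K : β → β → ℝ) (hK : ∀ b ∈ s, ∀ b' ∈ s, 0 ≤ K b b')
    (hsymm : ∀ b ∈ s, ∀ b' ∈ s, K b b' = K b' b) {C : ℝ} (hrow : ∀ b ∈ s, ∑ b' ∈ s, K b b' ≤ C)
    (θ : β → ℝ) : ∑ b ∈ s, ∑ b' ∈ s, K b b' * (θ b * θ b') ≤ C * ∑ b ∈ s, θ b ^ 2 := by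
  have hr : ∀ i : s, ∑ j : s, ‖K i j‖ ≤ C := by
    intro i
    rw [Finset.sum_coe_sort (s := s) (f := fun b' => ‖K i b'‖)]
    calc ∑ b' ∈ s, ‖K i b'‖ = ∑ b' ∈ s, K i b' :=
          sum_congr rfl fun b' hb' => Real.norm_of_nonneg (hK i i.2 b' hb')
      _ ≤ C := hrow i i.2
  have hc : ∀ j : s, ∑ i : s, ‖K i j‖ ≤ C := by
    intro j
    rw [Finset.sum_coe_sort (s := s) (f := fun b => ‖K b j‖)]
    calc ∑ b ∈ s, ‖K b j‖ = ∑ b ∈ s, K j b :=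
          sum_congr rfl fun b hb => by rw [Real.norm_of_nonneg (hK b hb j j.2), hsymm b hb j j.2]
      _ ≤ C := hrow j j.2
  have h := B13PerturbativeStep.norm_bilinForm_le (𝕜 := ℝ) (fun i j : s => K i j)
    (fun i : s => θ i) (fun i : s => θ i) hr hc
  have hsum : ∑ b ∈ s, ∑ b' ∈ s, K b b' * (θ b * θ b')
      = ∑ i : s, ∑ j : s, θ i * K i j * θ j := by
    rw [Finset.sum_coe_sort (s := s) (f := fun b => ∑ j : s, θ b * K b j * θ j)]
    refine sum_congr rfl fun b _ => ?_
    rw [Finset.sum_coe_sort (s := s) (f := fun b' => θ b * K b b' * θ b')]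
    exact sum_congr rfl fun b' _ => by ring
  have hsq : ∑ i : s, ‖θ i‖ ^ 2 = ∑ b ∈ s, θ b ^ 2 := by
    rw [Finset.sum_coe_sort (s := s) (f := fun b => ‖θ b‖ ^ 2)]
    exact sum_congr rfl fun b _ => by rw [Real.norm_eq_abs, sq_abs]
  rw [hsum]
  rw [hsq] at h
  calc ∑ i : s, ∑ j : s, θ i * K i j * θ j ≤ ‖∑ i : s, ∑ j : s, θ i * K i j * θ j‖ := Real.le_norm_self _
    _ ≤ 1 / 2 * (C * ∑ b ∈ s, θ b ^ 2 + C * ∑ b ∈ s, θ b ^ 2) := h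
    _ = C * ∑ b ∈ s, θ b ^ 2 := by ring

end Schur

/-! ## §3 Row sums of an exponentially decaying kernel on the unit lattice ℤ^d, with fibre multiplicity -/

section Lattice

variable {β : Type*} {d : ℕ}

/-- **Row sums with fibres**: for bonds `b ∈ s` with initial points `site b ∈ ℤ^d`, at most `m` bonds per initial point,
and `a > 0`: `Σ_{b′ ∈ s} e^{−a|x − site b′|_∞} ≤ m · C(d, a)` for every `x ∈ ℤ^d`, `C(d, a) = (2/(1 − e^{−a/d}))^d` the
window-independent constant of `B6KernelComposition.sum_exp_dist_le` (sup metric). [folklore] -/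
theorem rowSum_exp_dist_le (s : Finset β) (site : β → Pt d) {m : ℕ}
    (hfib : ∀ z, (s.filter fun b => site b = z).card ≤ m) {a : ℝ} (ha : 0 < a) (x : Pt d) :
    ∑ b ∈ s, Real.exp (-(a * dist x (site b))) ≤ m * latticeConst d a := by
  rw [← sum_fiberwise_of_maps_to' (s := s) (t := s.image site) (g := site)
    (fun b hb => mem_image_of_mem site hb) (fun z => Real.exp (-(a * dist x z)))]
  calc ∑ z ∈ s.image site, ∑ b ∈ s with site b = z, Real.exp (-(a * dist x z))
      = ∑ z ∈ s.image site, ((s.filter fun b => site b = z).card : ℝ) * Real.exp (-(a * dist x z)) := by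
        refine sum_congr rfl fun z _ => ?_
        rw [sum_const, nsmul_eq_mul]
    _ ≤ ∑ z ∈ s.image site, (m : ℝ) * Real.exp (-(a * dist x z)) := by
        refine sum_le_sum fun z _ => ?_
        exact mul_le_mul_of_nonneg_right (by exact_mod_cast hfib z) (Real.exp_nonneg _)
    _ = m * ∑ z ∈ s.image site, Real.exp (-(a * dist x z)) := by rw [mul_sum]
    _ ≤ m * latticeConst d a :=
        mul_le_mul_of_nonneg_left (sum_exp_dist_le _ x ha) (Nat.cast_nonneg _)

/-- **The lattice constant is explicit**: `C(d, a) ≤ (2(1 + d/a))^d` for `a > 0` (from `1 + t ≤ e^t`: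
`1/(1 − e^{−t}) ≤ 1 + 1/t` at `t = a/d`). [folklore] -/
theorem latticeConst_le (d : ℕ) {a : ℝ} (ha : 0 < a) : latticeConst d a ≤ (2 * (1 + d / a)) ^ d := by
  unfold latticeConst
  rcases Nat.eq_zero_or_pos d with hd | hd
  · subst hd
    simp
  have hdpos : (0 : ℝ) < d := by exact_mod_cast hd
  have htpos : 0 < a / d := div_pos ha hdpos
  have hexp : Real.exp (-(a / d)) ≤ (1 + a / d)⁻¹ := by
    rw [Real.exp_neg]
    exact inv_anti₀ (by positivity) (by linarith [Real.add_one_le_exp (a / d)])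
  have hlt : Real.exp (-(a / d)) < 1 := by
    rw [← Real.exp_zero]
    exact Real.exp_lt_exp.2 (by linarith)
  have h1 : 0 < 1 - Real.exp (-(a / d)) := by linarith
  have key : 2 / (1 - Real.exp (-(a / d))) ≤ 2 * (1 + d / a) := by
    rw [div_le_iff₀ h1]
    have hda : (d : ℝ) / a = (a / d)⁻¹ := by rw [inv_div]
    rw [hda]
    have h3 : (a / d) / (1 + a / d) ≤ 1 - Real.exp (-(a / d)) := by
      have h4 : (a / d) / (1 + a / d) = 1 - (1 + a / d)⁻¹ := by
        field_simp
        ring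
      linarith
    have h5 : (1 + (a / d)⁻¹) * ((a / d) / (1 + a / d)) = 1 := by
      field_simp
      ring
    calc (2 : ℝ) = 2 * ((1 + (a / d)⁻¹) * ((a / d) / (1 + a / d))) := by rw [h5, mul_one]
      _ ≤ 2 * ((1 + (a / d)⁻¹) * (1 - Real.exp (-(a / d)))) := by
          refine mul_le_mul_of_nonneg_left (mul_le_mul_of_nonneg_left h3 (by positivity)) (by norm_num)
      _ = 2 * (1 + (a / d)⁻¹) * (1 - Real.exp (-(a / d))) := by ring
  exact pow_le_pow_left₀ (div_nonneg zero_le_two h1.le) key d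

/-- **d = 4, the constant of (2.20) is M-uniform**: `M⁻⁴ · C(4, (κ₁−1)/(16M)) ≤ (2/M + 128/(κ₁−1))⁴ ≤ (2 + 128/(κ₁−1))⁴`
for `M ≥ 1`, `κ₁ > 1` — the volume factor `M⁴` of the row sum over unit-lattice points at decay rate `(κ₁−1)/(16M)`
cancels EXACTLY against the `M⁻⁴` of the matrix element, in dimension four. [folklore] -/
theorem rowConst_four_le {M κ₁ : ℝ} (hM : 1 ≤ M) (hκ₁ : 1 < κ₁) :
    (M ^ 4)⁻¹ * latticeConst 4 ((κ₁ - 1) / (16 * M)) ≤ (2 + 128 / (κ₁ - 1)) ^ 4 := by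
  have hM0 : 0 < M := by linarith
  have hk : 0 < κ₁ - 1 := by linarith
  have ha : 0 < (κ₁ - 1) / (16 * M) := by positivity
  have h := latticeConst_le 4 ha
  have hrw : (2 : ℝ) * (1 + (4 : ℕ) / ((κ₁ - 1) / (16 * M))) = 2 + 128 * M / (κ₁ - 1) := by
    push_cast
    field_simp
    ring
  rw [hrw] at h
  calc (M ^ 4)⁻¹ * latticeConst 4 ((κ₁ - 1) / (16 * M))
      ≤ (M ^ 4)⁻¹ * (2 + 128 * M / (κ₁ - 1)) ^ 4 := mul_le_mul_of_nonneg_left h (by positivity)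
    _ = (2 / M + 128 / (κ₁ - 1)) ^ 4 := by
        field_simp
    _ ≤ (2 + 128 / (κ₁ - 1)) ^ 4 := by
        refine pow_le_pow_left₀ (by positivity) ?_ 4
        have : 2 / M ≤ 2 := by
          rw [div_le_iff₀ hM0]
          linarith
        linarith

end Lattice

/-! ## §4 The two matrix elements of (2.20) over the constants record `B13.Consts` of [II] -/

section B13

/-- The matrix element of the first term of **(2.20)** p. 16 [16], verbatim: *"α₄M⁻⁴exp(−(1/16)(κ₁ − 1)M⁻¹|b₋ − b′₋|)"*
(`ρ` = |b₋ − b′₋|; the printed ½ and |B(b)||B(b′)| belong to the quadratic form). [cite: Balaban1988RG2Cluster, (2.20) p.16] -/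
def ker220 (c : B13.Consts) (ρ : ℝ) : ℝ :=
  c.α₄ * (c.M ^ 4)⁻¹ * Real.exp (-(1 / 16 * (c.κ₁ - 1) * (c.M⁻¹ * ρ)))

/-- The summand of the second term of **(2.20)** p. 16 [16], verbatim: *"α₄exp(−δκd_k(Y))"* (`dk` = d_k(Y)).
[cite: Balaban1988RG2Cluster, (2.20) p.16] -/
def vpp220 (c : B13.Consts) (dk : ℝ) : ℝ := c.α₄ * Real.exp (-(c.δ * c.κ * dk))

/-- The right side of **(1.36)** p. 9 [9] (*"E₀ε₁C₁M^q exp C₂κ₁ exp(−(1 − 2δ)κd_k(Y))"*) as a real function of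
`dk = d_k(Y)` (`bound136_iff_rhs136`: `B13.Bound136` is the pointwise bound by it). [cite: Balaban1988RG2Cluster, (1.36) p.9] -/
def rhs136 (c : B13.Consts) (dk : ℝ) : ℝ :=
  c.E₀ * c.ε₁ * c.C₁ * c.M ^ c.q * Real.exp (c.C₂ * c.κ₁) * Real.exp (-((1 - 2 * c.δ) * c.κ * dk))

/-- The "O(1)" of the first term of (2.20) in the lattice model of §3/§5: `m · M⁻⁴ · C(d, (κ₁−1)/(16M))`
(`m` = bonds per initial point, `C` = `B6KernelComposition.latticeConst`). [cite: Balaban1988RG2Cluster, (2.20) p.16] -/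
def O1 (c : B13.Consts) (d m : ℕ) : ℝ := (c.M ^ 4)⁻¹ * (m * latticeConst d ((c.κ₁ - 1) / (16 * c.M)))

/-- **The matrix element of (2.19) FACTORS** into the resummation weight `e^{−¼(κ₁−1)·M⁻⁴|Y|}` ("the first exponential
factor in (2.19)") and the matrix element of (2.20). [cite: Balaban1988RG2Cluster, (2.19)–(2.20) p.16] -/
theorem elem219_eq_exp_mul_ker220 (c : B13.Consts) (n ρ : ℝ) :
    elem219 c n ρ = Real.exp (-(1 / 4 * (c.κ₁ - 1) * n)) * ker220 c ρ := by
  unfold elem219 ker220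
  rw [show -(1 / 4) * (c.κ₁ - 1) * n - 1 / 16 * (c.κ₁ - 1) * (c.M⁻¹ * ρ)
      = -(1 / 4 * (c.κ₁ - 1) * n) + -(1 / 16 * (c.κ₁ - 1) * (c.M⁻¹ * ρ)) by ring, Real.exp_add]
  ring

/-- The (2.20) matrix element is non-negative for `α₄ ≥ 0`. [cite: Balaban1988RG2Cluster, (2.20) p.16] -/
theorem ker220_nonneg (c : B13.Consts) (hα : 0 ≤ c.α₄) (ρ : ℝ) : 0 ≤ ker220 c ρ := by
  unfold ker220
  positivity

/-- The (2.20) matrix element is antitone in the distance (κ₁ ≥ 1, M > 0, α₄ ≥ 0). [cite: Balaban1988RG2Cluster, (2.20) p.16] -/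
theorem ker220_antitone (c : B13.Consts) (hα : 0 ≤ c.α₄) (hκ₁ : 1 ≤ c.κ₁) (hM : 0 < c.M) {ρ ρ' : ℝ}
    (h : ρ ≤ ρ') : ker220 c ρ' ≤ ker220 c ρ := by
  unfold ker220
  refine mul_le_mul_of_nonneg_left (Real.exp_le_exp.2 ?_) (by positivity)
  have hk : 0 ≤ 1 / 16 * (c.κ₁ - 1) * c.M⁻¹ :=
    mul_nonneg (mul_nonneg (by norm_num) (by linarith)) (inv_nonneg.2 hM.le)
  have h2 := mul_le_mul_of_nonneg_left h hk
  apply neg_le_neg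
  calc 1 / 16 * (c.κ₁ - 1) * (c.M⁻¹ * ρ) = 1 / 16 * (c.κ₁ - 1) * c.M⁻¹ * ρ := by ring
    _ ≤ 1 / 16 * (c.κ₁ - 1) * c.M⁻¹ * ρ' := h2
    _ = 1 / 16 * (c.κ₁ - 1) * (c.M⁻¹ * ρ') := by ring

/-- The (2.20) matrix element at decay rate `(κ₁−1)/(16M)`. [cite: Balaban1988RG2Cluster, (2.20) p.16] -/
theorem ker220_eq (c : B13.Consts) (ρ : ℝ) :
    ker220 c ρ = c.α₄ * (c.M ^ 4)⁻¹ * Real.exp (-((c.κ₁ - 1) / (16 * c.M) * ρ)) := by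
  unfold ker220
  rw [show -(1 / 16 * (c.κ₁ - 1) * (c.M⁻¹ * ρ)) = -((c.κ₁ - 1) / (16 * c.M) * ρ) by ring]

/-- **ROW SUMS OF THE (2.20) KERNEL ON THE UNIT LATTICE** (the "O(1)" of the second inequality of (2.20), first term):
for bonds `b ∈ s` with initial points `site b = b₋ ∈ ℤ^d`, at most `m` bonds per initial point, a distance reading
`ρ(b, b′) ≥ |b₋ − b′₋|_∞` (the sup metric is the smallest of the three census readings sup ∕ ℓ¹ ∕ ℓ² of D-T2, so the
bound serves all three), `κ₁ > 1`, `M > 0`, `α₄ ≥ 0`:  `Σ_{b′ ∈ s} ker220(ρ(b, b′)) ≤ O1 · α₄`,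
`O1 = m·M⁻⁴·C(d, (κ₁−1)/(16M))`. [cite: Balaban1988RG2Cluster, (2.20) p.16] -/
theorem rowSum_ker220_le {β : Type*} {d : ℕ} (c : B13.Consts) (hα : 0 ≤ c.α₄) (hκ₁ : 1 < c.κ₁)
    (hM : 0 < c.M) (s : Finset β) (site : β → Pt d) {m : ℕ}
    (hfib : ∀ z, (s.filter fun b => site b = z).card ≤ m) (ρ : β → β → ℝ)
    (hρ : ∀ b ∈ s, ∀ b' ∈ s, dist (site b) (site b') ≤ ρ b b') (b : β) (hb : b ∈ s) :
    ∑ b' ∈ s, ker220 c (ρ b b') ≤ O1 c d m * c.α₄ := by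
  have ha : 0 < (c.κ₁ - 1) / (16 * c.M) := by
    have : 0 < c.κ₁ - 1 := by linarith
    positivity
  calc ∑ b' ∈ s, ker220 c (ρ b b') ≤ ∑ b' ∈ s, ker220 c (dist (site b) (site b')) :=
        sum_le_sum fun b' hb' => ker220_antitone c hα hκ₁.le hM (hρ b hb b' hb')
    _ = c.α₄ * (c.M ^ 4)⁻¹ *
          ∑ b' ∈ s, Real.exp (-((c.κ₁ - 1) / (16 * c.M) * dist (site b) (site b'))) := by
        rw [mul_sum]
        exact sum_congr rfl fun b' _ => ker220_eq c _
    _ ≤ c.α₄ * (c.M ^ 4)⁻¹ * (m * latticeConst d ((c.κ₁ - 1) / (16 * c.M))) :=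
        mul_le_mul_of_nonneg_left (rowSum_exp_dist_le s site hfib ha (site b)) (by positivity)
    _ = O1 c d m * c.α₄ := by
        unfold O1
        ring

/-- **|τ(Y)| × (the V″ summand) IS the right side of (1.36), EXACTLY**: with 1/|τ(Y)| of (2.18),
`(1/|τ(Y)|) · α₄e^{−δκd} = E₀ε₁C₁M^q e^{C₂κ₁} e^{−(1−2δ)κd}` (the exp C₂κ₁'s and E₀ε₁C₁M^q are carried by τ; the rates
add: (1 − 3δ) + δ = 1 − 2δ) — the reason the second sum of (2.20) reads *"Σ_{Y∈D} α₄exp(−δκd_k(Y))"*.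
[cite: Balaban1988RG2Cluster, (2.18)/(2.20) p.16, (1.36) p.9] -/
theorem invTau_mul_vpp220 (c : B13.Consts) (hα : c.α₄ ≠ 0) (dk : ℝ) :
    invTau c dk * vpp220 c dk = rhs136 c dk := by
  unfold invTau vpp220 rhs136
  have e : Real.exp (-(1 - 3 * c.δ) * c.κ * dk) * Real.exp (-(c.δ * c.κ * dk)) =
      Real.exp (-((1 - 2 * c.δ) * c.κ * dk)) := by
    rw [← Real.exp_add]
    congr 1
    ring
  calc c.E₀ * c.ε₁ * c.C₁ * c.α₄⁻¹ * c.M ^ c.q * Real.exp (c.C₂ * c.κ₁) *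
          Real.exp (-(1 - 3 * c.δ) * c.κ * dk) * (c.α₄ * Real.exp (-(c.δ * c.κ * dk)))
      = c.E₀ * c.ε₁ * c.C₁ * c.M ^ c.q * Real.exp (c.C₂ * c.κ₁) * (c.α₄⁻¹ * c.α₄) *
          (Real.exp (-(1 - 3 * c.δ) * c.κ * dk) * Real.exp (-(c.δ * c.κ * dk))) := by ring
    _ = c.E₀ * c.ε₁ * c.C₁ * c.M ^ c.q * Real.exp (c.C₂ * c.κ₁) *
          Real.exp (-((1 - 2 * c.δ) * c.κ * dk)) := by
        rw [inv_mul_cancel₀ hα, e]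
        ring

/-- `(1/|τ(Y)|)⁻¹ · (right side of (1.36)) = α₄e^{−δκd}` (E₀, ε₁, C₁, α₄, M > 0). [cite: Balaban1988RG2Cluster, (2.18)/(2.20) p.16] -/
theorem invTau_inv_mul_rhs136 (c : B13.Consts) (hE : 0 < c.E₀) (hε : 0 < c.ε₁) (hC₁ : 0 < c.C₁)
    (hα : 0 < c.α₄) (hM : 0 < c.M) (dk : ℝ) : (invTau c dk)⁻¹ * rhs136 c dk = vpp220 c dk := by
  rw [← invTau_mul_vpp220 c hα.ne' dk, inv_mul_cancel_left₀ (invTau_pos c hE hε hC₁ hα hM dk).ne']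

/-- `B13.Bound136 S c F` is, definitionally, the pointwise bound of `F` by `rhs136 c (d_k Y)` on the spaces (1.34).
[cite: Balaban1988RG2Cluster, (1.36) p.9] -/
theorem bound136_iff_rhs136 (S : B13.StepData) (c : B13.Consts) (F : S.Dk.Dom → S.Φ → ℂ) :
    B13.Bound136 S c F ↔ ∀ Y φ, φ ∈ S.sp1 Y → ‖F Y φ‖ ≤ rhs136 c (S.Dk.dj Y) :=
  Iff.rfl

/-- **THE V″ INPUT OF (2.20) FROM LEMMA 2's (1.36)**: if `F` (= V″_k) satisfies (1.36) (`B13.Bound136 S c F`), then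
`|τ(Y)| · |F(Y, φ)| ≤ α₄ exp(−δκd_k(Y))` on the space (1.34) of `Y` — the summand of the second sum in (2.20).
[cite: Balaban1988RG2Cluster, (2.20) p.16] -/
theorem vpp_of_bound136 (S : B13.StepData) (c : B13.Consts) {F : S.Dk.Dom → S.Φ → ℂ}
    (h136 : B13.Bound136 S c F) (hE : 0 < c.E₀) (hε : 0 < c.ε₁) (hC₁ : 0 < c.C₁) (hα : 0 < c.α₄)
    (hM : 0 < c.M) (Y : S.Dk.Dom) (φ : S.Φ) (hφ : φ ∈ S.sp1 Y) :
    (invTau c (S.Dk.dj Y))⁻¹ * ‖F Y φ‖ ≤ vpp220 c (S.Dk.dj Y) := by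
  rw [← invTau_inv_mul_rhs136 c hE hε hC₁ hα hM]
  exact mul_le_mul_of_nonneg_left (h136 Y φ hφ) (inv_nonneg.2 (invTau_pos c hE hε hC₁ hα hM _).le)

end B13

/-! ## §5 (2.19) ⇒ (2.20): the sum over the family D -/

section Main

variable {V β : Type*} [DecidableEq V] {R : V → V → Prop} {nbr : V → Finset V} {Δ : ℕ}

omit [DecidableEq V] in
/-- **Union bound over the cubes of Y₀ = ⋃ D**: for non-empty members and `f ≥ 0`,
`Σ_{Y ∈ D} f(Y) ≤ Σ_{□ ∈ Y₀} Σ_{Y ∈ D, Y ∋ □} f(Y)` (each `Y` is counted `#Y ≥ 1` times on the right). [folklore] -/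
theorem sum_le_sum_biUnion [DecidableEq V] (D : Finset (Finset V)) (hD : ∀ Y ∈ D, Y.Nonempty)
    (f : Finset V → ℝ) (hf : ∀ Y ∈ D, 0 ≤ f Y) :
    ∑ Y ∈ D, f Y ≤ ∑ x ∈ D.biUnion id, ∑ Y ∈ D with x ∈ Y, f Y := by
  calc ∑ Y ∈ D, f Y ≤ ∑ Y ∈ D, (Y.card : ℝ) * f Y := by
        refine sum_le_sum fun Y hY => le_mul_of_one_le_left (hf Y hY) ?_
        exact Nat.one_le_cast.2 (Nat.one_le_iff_ne_zero.2 (card_ne_zero.2 (hD Y hY)))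
    _ = ∑ Y ∈ D, ∑ x ∈ D.biUnion id, if x ∈ Y then f Y else 0 := by
        refine sum_congr rfl fun Y hY => ?_
        rw [← sum_filter]
        have hfilt : (D.biUnion id).filter (fun x => x ∈ Y) = Y := by
          ext x
          simp only [mem_filter, mem_biUnion, id_eq, and_iff_right_iff_imp]
          exact fun hx => ⟨Y, hY, hx⟩
        rw [hfilt, sum_const, nsmul_eq_mul]
    _ = ∑ x ∈ D.biUnion id, ∑ Y ∈ D, if x ∈ Y then f Y else 0 := sum_comm
    _ = ∑ x ∈ D.biUnion id, ∑ Y ∈ D with x ∈ Y, f Y := by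
        refine sum_congr rfl fun x _ => ?_
        rw [sum_filter]

/-- **(2.20), FIRST INEQUALITY** ([Balaban1988RG2Cluster] p. 16 [16], verbatim: *"Σ_{Y∈D}|τ(Y)||V_k(Y,B)| ≤
½Σ_{b,b′⊂Y₀}α₄M⁻⁴exp(−(1/16)(κ₁ − 1)M⁻¹|b₋ − b′₋|)|B(b)||B(b′)| + Σ_{Y∈D}α₄exp(−δκd_k(Y))"*), kernel form over
abstract data.  Cells `V`, symmetric adjacency `R` of degree `≤ Δ`; `D` a finite family of (distinct) `R`-connected cell
sets (the localization domains Y of the Mayer term (2.1)); `s` = the bonds of Y₀, `sY Y ⊆ s` the bonds b ⊂ Y, whose cube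
`cube b` lies in Y; `θ_b = |B(b)| ≥ 0`; per Y, the INPUTS in the shape (2.19) delivers them — the quadratic part
`q(Y, b, b′) = |τ(Y)||Q(Y, B, b, b′)| ≤ elem219(M⁻⁴|Y| = #Y, ρ(b, b′))` (= the output of
`B13Bound143.tau_mul_le_elem219` ∕ `B13DiameterG6.tau_mul_le_elem219_sup/_l1/_l2`) and the V″ part
`v(Y) = |τ(Y)||V″_k(Y, B)| ≤ α₄e^{−δκd_k(Y)}` (= `vpp_of_bound136`) — and the smallness `¼(κ₁ − 1) ≥ a₀(Δ) = log 2(Δ+1)²`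
("for κ₁ large").  Then `Σ_{Y∈D} (½ Σ_{b,b′⊂Y} q θ_b θ_{b′} + v(Y)) ≤ ½ Σ_{b,b′⊂Y₀} ker220(ρ(b,b′)) θ_b θ_{b′} + Σ_{Y∈D}
α₄e^{−δκd_k(Y)}`: the resummation constant is `(Δ+1)^{−2} ≤ 1` (`resum_quadForm`). [cite: Balaban1988RG2Cluster, (2.20) p.16 (first inequality)] -/
theorem ineq220_middle (hR : ∀ x y, R x y → R y x) (hΔ : ∀ x, (nbr x).card ≤ Δ)
    (hnbr : ∀ x y, R x y → y ∈ nbr x) (c : B13.Consts) (hα : 0 ≤ c.α₄)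
    (hκ₁ : a₀ Δ ≤ 1 / 4 * (c.κ₁ - 1)) (D : Finset (Finset V)) (hD : ∀ Y ∈ D, IsRConnected R Y)
    (s : Finset β) (sY : Finset V → Finset β) (hsY : ∀ Y ∈ D, sY Y ⊆ s) (cube : β → V)
    (hcube : ∀ Y ∈ D, ∀ b ∈ sY Y, cube b ∈ Y) (ρ : β → β → ℝ) (θ : β → ℝ) (hθ : ∀ b ∈ s, 0 ≤ θ b)
    (q : Finset V → β → β → ℝ)
    (hq : ∀ Y ∈ D, ∀ b ∈ sY Y, ∀ b' ∈ sY Y, q Y b b' ≤ elem219 c Y.card (ρ b b'))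
    (dk : Finset V → ℝ) (v : Finset V → ℝ) (hv : ∀ Y ∈ D, v Y ≤ vpp220 c (dk Y)) :
    ∑ Y ∈ D, (1 / 2 * ∑ b ∈ sY Y, ∑ b' ∈ sY Y, q Y b b' * (θ b * θ b') + v Y)
      ≤ 1 / 2 * ∑ b ∈ s, ∑ b' ∈ s, ker220 c (ρ b b') * (θ b * θ b') + ∑ Y ∈ D, vpp220 c (dk Y) := by
  rw [sum_add_distrib]
  refine add_le_add ?_ (sum_le_sum hv)
  rw [← mul_sum]
  refine mul_le_mul_of_nonneg_left ?_ (by norm_num)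
  have hF : ∀ b ∈ s, ∀ b' ∈ s, 0 ≤ ker220 c (ρ b b') * (θ b * θ b') :=
    fun b hb b' hb' => mul_nonneg (ker220_nonneg c hα _) (mul_nonneg (hθ b hb) (hθ b' hb'))
  calc ∑ Y ∈ D, ∑ b ∈ sY Y, ∑ b' ∈ sY Y, q Y b b' * (θ b * θ b')
      ≤ ∑ Y ∈ D, ∑ b ∈ sY Y, ∑ b' ∈ sY Y,
          Real.exp (-(1 / 4 * (c.κ₁ - 1) * Y.card)) * (ker220 c (ρ b b') * (θ b * θ b')) := by
        refine sum_le_sum fun Y hY => sum_le_sum fun b hb => sum_le_sum fun b' hb' => ?_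
        have hθθ : 0 ≤ θ b * θ b' := mul_nonneg (hθ b (hsY Y hY hb)) (hθ b' (hsY Y hY hb'))
        calc q Y b b' * (θ b * θ b') ≤ elem219 c Y.card (ρ b b') * (θ b * θ b') :=
              mul_le_mul_of_nonneg_right (hq Y hY b hb b' hb') hθθ
          _ = _ := by rw [elem219_eq_exp_mul_ker220]; ring
    _ ≤ 1 / ((Δ : ℝ) + 1) ^ 2 * ∑ b ∈ s, ∑ b' ∈ s, ker220 c (ρ b b') * (θ b * θ b') :=
        resum_quadForm hR hΔ hnbr hκ₁ D hD s sY hsY cube hcube _ hF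
    _ ≤ 1 * ∑ b ∈ s, ∑ b' ∈ s, ker220 c (ρ b b') * (θ b * θ b') := by
        refine mul_le_mul_of_nonneg_right ?_
          (sum_nonneg fun b hb => sum_nonneg fun b' hb' => hF b hb b' hb')
        rw [div_le_one (by positivity)]
        have : (0 : ℝ) ≤ Δ := Nat.cast_nonneg _
        nlinarith
    _ = _ := one_mul _

/-- **(2.20), BOTH INEQUALITIES** ([Balaban1988RG2Cluster] p. 16 [16], verbatim: *"… ≤ ½O(1)α₄Σ_{b⊂Y₀}|B(b)|² +
O(1)α₄M⁻⁴|Y₀|. (2.20)"*), kernel form over abstract data, the two O(1)'s EXPLICIT as hypotheses on the model: to the data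
of `ineq220_middle` add a symmetric distance reading `ρ` whose (2.20)-kernel has row sums `≤ C` on the bonds of Y₀ (the
first "O(1)·α₄"; for the unit lattice: `rowSum_ker220_le`), and a (1.26)-type bound at rate δκ for the family through
each cube of Y₀ = ⋃ D, `Σ_{Y∈D, Y∋□} e^{−δκd_k(Y)} ≤ K` (the second "O(1)"; for the formalised tree length: pv22's
`TreeLengthCubeSystem.sum_exp_treeLen_le`).  Then, with `#Y₀` = the number of cubes of Y₀ = M⁻⁴|Y₀|:
`Σ_{Y∈D} (½ Σ_{b,b′⊂Y} q θθ + v(Y)) ≤ ½·C·Σ_{b⊂Y₀} θ_b² + K·α₄·#Y₀`.  Quadratic step = `quadForm_le_of_rowSum` (the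
Schur / AM–GM bound of (2.21)); V″ step = the union bound over the cubes of Y₀. [cite: Balaban1988RG2Cluster, (2.20) p.16] -/
theorem ineq220 (hR : ∀ x y, R x y → R y x) (hΔ : ∀ x, (nbr x).card ≤ Δ)
    (hnbr : ∀ x y, R x y → y ∈ nbr x) (c : B13.Consts) (hα : 0 ≤ c.α₄)
    (hκ₁ : a₀ Δ ≤ 1 / 4 * (c.κ₁ - 1)) (D : Finset (Finset V)) (hD : ∀ Y ∈ D, IsRConnected R Y)
    (s : Finset β) (sY : Finset V → Finset β) (hsY : ∀ Y ∈ D, sY Y ⊆ s) (cube : β → V)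
    (hcube : ∀ Y ∈ D, ∀ b ∈ sY Y, cube b ∈ Y) (ρ : β → β → ℝ)
    (hρsymm : ∀ b ∈ s, ∀ b' ∈ s, ρ b b' = ρ b' b) {C : ℝ}
    (hrow : ∀ b ∈ s, ∑ b' ∈ s, ker220 c (ρ b b') ≤ C) (θ : β → ℝ) (hθ : ∀ b ∈ s, 0 ≤ θ b)
    (q : Finset V → β → β → ℝ)
    (hq : ∀ Y ∈ D, ∀ b ∈ sY Y, ∀ b' ∈ sY Y, q Y b b' ≤ elem219 c Y.card (ρ b b'))
    (dk : Finset V → ℝ) (v : Finset V → ℝ) (hv : ∀ Y ∈ D, v Y ≤ vpp220 c (dk Y)) {K : ℝ}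
    (h126 : ∀ x ∈ D.biUnion id, ∑ Y ∈ D with x ∈ Y, Real.exp (-(c.δ * c.κ * dk Y)) ≤ K) :
    ∑ Y ∈ D, (1 / 2 * ∑ b ∈ sY Y, ∑ b' ∈ sY Y, q Y b b' * (θ b * θ b') + v Y)
      ≤ 1 / 2 * C * ∑ b ∈ s, θ b ^ 2 + K * c.α₄ * (D.biUnion id).card := by
  refine (ineq220_middle hR hΔ hnbr c hα hκ₁ D hD s sY hsY cube hcube ρ θ hθ q hq dk v hv).trans
    (add_le_add ?_ ?_)
  · rw [mul_assoc]
    refine mul_le_mul_of_nonneg_left ?_ (by norm_num)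
    exact quadForm_le_of_rowSum s (fun b b' => ker220 c (ρ b b')) (fun b _ b' _ => ker220_nonneg c hα _)
      (fun b hb b' hb' => by simp only [hρsymm b hb b' hb']) hrow θ
  · have hne : ∀ Y ∈ D, Y.Nonempty := fun Y hY => (hD Y hY).1
    calc ∑ Y ∈ D, vpp220 c (dk Y) = c.α₄ * ∑ Y ∈ D, Real.exp (-(c.δ * c.κ * dk Y)) := by
          simp only [vpp220, mul_sum]
      _ ≤ c.α₄ * ∑ x ∈ D.biUnion id, ∑ Y ∈ D with x ∈ Y, Real.exp (-(c.δ * c.κ * dk Y)) :=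
          mul_le_mul_of_nonneg_left (sum_le_sum_biUnion D hne _ fun Y _ => Real.exp_nonneg _) hα
      _ ≤ c.α₄ * ∑ x ∈ D.biUnion id, K := mul_le_mul_of_nonneg_left (sum_le_sum h126) hα
      _ = K * c.α₄ * (D.biUnion id).card := by
          rw [sum_const, nsmul_eq_mul]
          ring

end Main

/-! ## §6 The lattice instance: cubes of ℤ^d with common-wall adjacency, bonds of the unit lattice, `treeLen` -/

section LatticeInstance

variable {d : ℕ}

/-- **(2.20) ON THE LATTICE, dimension d** — the two O(1)'s DISCHARGED: cubes = ℤ^d indices with common-wall adjacency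
(Δ = 2d), `D` a finite family of distinct localization domains (non-empty, face-connected), the bonds of Y₀ indexed by
`s` with `cube b ∈ Y` for b ⊂ Y, initial points `site b = b₋` on the unit lattice ℤ^d with at most `m` bonds per
point, a symmetric distance reading `ρ ≥ sup-distance of the initial points`, the tree length `treeLen` of pv22.  Under
`¼(κ₁−1) ≥ a₀(2d) = log 2(2d+1)²`, `κ₁ > 1`, `M > 0`, `α₄ ≥ 0`, `δκ ≥ κ₀(4·2^d, 2d)`:
`Σ_{Y∈D} (½ Σ_{b,b′⊂Y} q θθ + v(Y)) ≤ ½·(O1·α₄)·Σ_{b⊂Y₀} θ_b² + K₀(4·2^d, 2d)·α₄·#Y₀` with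
`O1 = m·M⁻⁴·C(d, (κ₁−1)/(16M))` and pv03's `K₀`.  The cube model (`nbrZ`, `card_nbrZ_le`,
`isRConnected_of_faceConnected`) and (1.26) for the tree length on ℤ^d (`sum_exp_treeLen_le`, applied to the family of
the members of D through a cube) are unit b03's `B12Ext436Lattice`. [cite: Balaban1988RG2Cluster, (2.20) p.16] -/
theorem ineq220_lattice {β : Type*} (c : B13.Consts) (hα : 0 ≤ c.α₄) (hM : 0 < c.M) (hκ₁' : 1 < c.κ₁)
    (hκ₁ : a₀ (2 * d) ≤ 1 / 4 * (c.κ₁ - 1)) (hδκ : kappa₀ (4 * 2 ^ d) (2 * d) ≤ c.δ * c.κ)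
    (D : Finset (Finset (Pt d))) (hD : ∀ Y ∈ D, Y.Nonempty ∧ FaceConnected Y)
    (s : Finset β) (sY : Finset (Pt d) → Finset β) (hsY : ∀ Y ∈ D, sY Y ⊆ s)
    (cube : β → Pt d) (hcube : ∀ Y ∈ D, ∀ b ∈ sY Y, cube b ∈ Y)
    (site : β → Pt d) {m : ℕ} (hfib : ∀ z, (s.filter fun b => site b = z).card ≤ m)
    (ρ : β → β → ℝ) (hρsymm : ∀ b ∈ s, ∀ b' ∈ s, ρ b b' = ρ b' b)
    (hρ : ∀ b ∈ s, ∀ b' ∈ s, dist (site b) (site b') ≤ ρ b b')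
    (θ : β → ℝ) (hθ : ∀ b ∈ s, 0 ≤ θ b) (q : Finset (Pt d) → β → β → ℝ)
    (hq : ∀ Y ∈ D, ∀ b ∈ sY Y, ∀ b' ∈ sY Y, q Y b b' ≤ elem219 c Y.card (ρ b b'))
    (v : Finset (Pt d) → ℝ) (hv : ∀ Y ∈ D, v Y ≤ vpp220 c (treeLen Y)) :
    ∑ Y ∈ D, (1 / 2 * ∑ b ∈ sY Y, ∑ b' ∈ sY Y, q Y b b' * (θ b * θ b') + v Y)
      ≤ 1 / 2 * (O1 c d m * c.α₄) * ∑ b ∈ s, θ b ^ 2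
        + K₀ (4 * 2 ^ d) (2 * d) * c.α₄ * (D.biUnion id).card := by
  classical
  refine ineq220 (R := Adj) (nbr := nbrZ) (Δ := 2 * d) (fun x y h => h.symm) card_nbrZ_le
    (fun x y h => mem_nbrZ h) c hα hκ₁ D
    (fun Y hY => isRConnected_of_faceConnected (hD Y hY).1 (hD Y hY).2) s sY hsY cube hcube ρ hρsymm
    (fun b hb => rowSum_ker220_le c hα hκ₁' hM s site hfib ρ hρ b hb) θ hθ q hq treeLen v hv
    fun x _ => ?_
  -- (1.26) for `treeLen` on ℤ^d (unit b03), for the family of the members of D through the cube x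
  have e : ∀ Y : Finset (Pt d),
      Real.exp (-(c.δ * c.κ * treeLen Y)) = Real.exp (-(c.δ * c.κ) * treeLen Y) := fun Y => by
    rw [neg_mul]
  simp_rw [e]
  exact sum_exp_treeLen_le hδκ x (D.filter fun Y => x ∈ Y) fun Y hY =>
    ⟨(mem_filter.1 hY).2, hD Y (mem_filter.1 hY).1⟩

/-- **(2.20) FOR d = 4 WITH NUMERICAL THRESHOLDS AND AN M-UNIFORM "O(1)"**: under `κ₁ ≥ 1 + 4 log 162` (≈ 21.35; this is
`¼(κ₁−1) ≥ a₀(8)`), `δκ ≥ 64 log 162` (= κ₀(64, 8), pv22's `kappa₀_four`), `M ≥ 1`, `α₄ ≥ 0`, the data of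
`ineq220_lattice` at d = 4 give
`Σ_{Y∈D} (½ Σ_{b,b′⊂Y} q θθ + v(Y)) ≤ ½·(m(2 + 128/(κ₁−1))⁴·α₄)·Σ_{b⊂Y₀} θ_b² + K₀(64, 8)·α₄·#Y₀` — both "O(1)" of the
printed (2.20) are ABSOLUTE numbers in dimension four (`rowConst_four_le`: the M⁴ of the unit-lattice row sum against the
M⁻⁴ of the matrix element). [cite: Balaban1988RG2Cluster, (2.20) p.16] -/
theorem ineq220_four {β : Type*} (c : B13.Consts) (hα : 0 ≤ c.α₄) (hM : 1 ≤ c.M)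
    (hκ₁ : 1 + 4 * Real.log 162 ≤ c.κ₁) (hδκ : 64 * Real.log 162 ≤ c.δ * c.κ)
    (D : Finset (Finset (Pt 4))) (hD : ∀ Y ∈ D, Y.Nonempty ∧ FaceConnected Y)
    (s : Finset β) (sY : Finset (Pt 4) → Finset β) (hsY : ∀ Y ∈ D, sY Y ⊆ s)
    (cube : β → Pt 4) (hcube : ∀ Y ∈ D, ∀ b ∈ sY Y, cube b ∈ Y)
    (site : β → Pt 4) {m : ℕ} (hfib : ∀ z, (s.filter fun b => site b = z).card ≤ m)
    (ρ : β → β → ℝ) (hρsymm : ∀ b ∈ s, ∀ b' ∈ s, ρ b b' = ρ b' b)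
    (hρ : ∀ b ∈ s, ∀ b' ∈ s, dist (site b) (site b') ≤ ρ b b')
    (θ : β → ℝ) (hθ : ∀ b ∈ s, 0 ≤ θ b) (q : Finset (Pt 4) → β → β → ℝ)
    (hq : ∀ Y ∈ D, ∀ b ∈ sY Y, ∀ b' ∈ sY Y, q Y b b' ≤ elem219 c Y.card (ρ b b'))
    (v : Finset (Pt 4) → ℝ) (hv : ∀ Y ∈ D, v Y ≤ vpp220 c (treeLen Y)) :
    ∑ Y ∈ D, (1 / 2 * ∑ b ∈ sY Y, ∑ b' ∈ sY Y, q Y b b' * (θ b * θ b') + v Y)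
      ≤ 1 / 2 * (m * (2 + 128 / (c.κ₁ - 1)) ^ 4 * c.α₄) * ∑ b ∈ s, θ b ^ 2
        + K₀ 64 8 * c.α₄ * (D.biUnion id).card := by
  have hlog : 0 < Real.log 162 := Real.log_pos (by norm_num)
  have hκ₁' : 1 < c.κ₁ := by linarith
  have ha₀ : a₀ (2 * 4) ≤ 1 / 4 * (c.κ₁ - 1) := by
    have : a₀ (2 * 4) = Real.log 162 := by norm_num [a₀]
    rw [this]
    linarith
  have hk : kappa₀ (4 * 2 ^ 4) (2 * 4) ≤ c.δ * c.κ := by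
    rw [TreeLengthCubeSystem.kappa₀_four]
    exact hδκ
  have h := ineq220_lattice c hα (by linarith) hκ₁' ha₀ hk D hD s sY hsY cube hcube site hfib ρ hρsymm hρ
    θ hθ q hq v hv
  have hK : K₀ (4 * 2 ^ 4) (2 * 4) = K₀ 64 8 := by norm_num
  rw [hK] at h
  refine h.trans (add_le_add ?_ le_rfl)
  have hO : O1 c 4 m * c.α₄ ≤ m * (2 + 128 / (c.κ₁ - 1)) ^ 4 * c.α₄ := by
    refine mul_le_mul_of_nonneg_right ?_ hα
    unfold O1
    calc (c.M ^ 4)⁻¹ * ((m : ℝ) * latticeConst 4 ((c.κ₁ - 1) / (16 * c.M)))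
        = m * ((c.M ^ 4)⁻¹ * latticeConst 4 ((c.κ₁ - 1) / (16 * c.M))) := by ring
      _ ≤ m * (2 + 128 / (c.κ₁ - 1)) ^ 4 :=
          mul_le_mul_of_nonneg_left (rowConst_four_le hM hκ₁') (Nat.cast_nonneg _)
  have hS : 0 ≤ ∑ b ∈ s, θ b ^ 2 := sum_nonneg fun b _ => sq_nonneg _
  nlinarith [mul_le_mul_of_nonneg_right hO hS]

end LatticeInstance

end

end Literature.MathematicalPhysics.QuantumFieldTheory.Balaban1983to89.B13Resum220
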